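import Mathlib
import Summits.Ventures.PercRepro2.Defs
import Summits.Ventures.PercRepro2.Harris
import Summits.Ventures.PercRepro2.Graph
import Summits.Ventures.PercRepro2.Events
import Summits.Ventures.PercRepro2.PsiPendantLemmas
import Summits.Ventures.PercRepro2.PsiUniExplored
import Summits.Ventures.PercRepro2.PsiTEdge

/-!
# An edge inside the explored `t`-component changes nothing (PercRepro2, p2)

If both ends of `f` lie in the explored `t`-component of `p` (the component of `t` along the
pinned-open edges), then on a configuration respecting the open pins off `f` the two pins of `f`
give the same connections: the ends are already joined along pinned-open edges.  Consequently every
connection event has the same probability at `p[f↦0]` and `p[f↦1]` (`prob_update_eq_of_internal`),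
and the sixteen pinned masses of the (Ψ)-slack coincide — the glue for the internal-edge case of the
`t`-exploration frame (P2-G18-BERN.md §7h).

* `conn_update_true_iff_of_internal` — the pointwise statement;
* `prob_update_eq_of_internal` — the probabilities of a connection event agree at both pins.
-/

namespace Summit.Ventures.PercRepro2

section Internal

variable {V : Type*} {E : Type*} [DecidableEq E] {R : Type*} [CommRing R] [LinearOrder R]

/-- With both ends of `f` in the explored component and `ω` respecting the open pins off `f`,
opening or closing `f` changes no connection. -/
lemma conn_update_true_iff_of_internal {ends : E → Sym2 V} {p : E → R} {ω : Config E} {f : E}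
    {t a b x z : V} (hf : ends f = s(a, b))
    (ha : Conn ends (fun e => decide (p e = 1)) t a) (hb : Conn ends (fun e => decide (p e = 1)) t b)
    (hpf : p f ≠ 1) (h1 : ∀ e, e ≠ f → p e = 1 → ω e = true) :
    Conn ends (Function.update ω f true) x z ↔ Conn ends (Function.update ω f false) x z := by
  have hle : (fun e => decide (p e = 1)) ≤ Function.update ω f false := by
    refine pinned_le_of_respects_off hpf fun e he hpe => ?_
    rw [Function.update_of_ne he]; exact h1 e he hpe
  have hab : Conn ends (Function.update ω f false) a b :=
    conn_trans (conn_symm (conn_mono hle ha)) (conn_mono hle hb)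
  constructor
  · intro h
    -- the closed-world cluster of `x` is closed under the open-world edges
    have hS : ∀ c ∈ {v | Conn ends (Function.update ω f false) x v}, ∀ d,
        (openGraph ends (Function.update ω f true)).Adj c d →
          d ∈ {v | Conn ends (Function.update ω f false) x v} := by
      intro c hc d hcd
      simp only [Set.mem_setOf_eq] at hc ⊢
      obtain ⟨hne, e, he, hends⟩ := openGraph_adj.1 hcd
      by_cases hef : e = f
      · subst hef
        rw [hf] at hends
        rcases Sym2.eq_iff.1 hends with ⟨rfl, rfl⟩ | ⟨rfl, rfl⟩
        · exact conn_trans hc hab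
        · exact conn_trans hc (conn_symm hab)
      · rw [Function.update_of_ne hef] at he
        have hadj : (openGraph ends (Function.update ω f false)).Adj c d :=
          openGraph_adj.2 ⟨hne, e, by rw [Function.update_of_ne hef]; exact he, hends⟩
        exact conn_trans hc (SimpleGraph.Adj.reachable hadj)
    exact mem_of_conn_of_closed hS (conn_refl _ _ _) h
  · exact conn_mono (update_false_le_update_true ω f)

end Internal

section InternalProb

variable {V : Type*} {E : Type*} [Fintype E] [DecidableEq E] {R : Type*} [CommRing R]
  [LinearOrder R]

/-- With both ends of `f` in the explored component, a connection event has the same probability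
with `f` pinned open and pinned closed. -/
lemma prob_update_eq_of_internal (p : E → R) (ends : E → Sym2 V) {f : E} {t a b x z : V}
    (hf : ends f = s(a, b))
    (ha : Conn ends (fun e => decide (p e = 1)) t a) (hb : Conn ends (fun e => decide (p e = 1)) t b)
    (hpf : p f ≠ 1) :
    prob (Function.update p f 1) (connEvent ends x z) =
      prob (Function.update p f 0) (connEvent ends x z) := by
  refine prob_update_one_eq_prob_update_zero_of_respects p f fun ω _ h1 => ?_
  simp only [mem_connEvent]
  exact conn_update_true_iff_of_internal hf ha hb hpf h1

end InternalProb

end Summit.Ventures.PercRepro2
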